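import Mathlib
import Summits.Ventures.HodgeRepro2.A2WeilProjection
import Summits.Ventures.HodgeRepro2.A2PontryaginModel

/-!
# A2 annex — `p_W(y) ≠ 0` iff a period `∫_B z ∧ w_σ` is non-zero (the class `y = z ⋆ θ⁴` of Theorem A)

Sub-claim A2's class `y = z ⋆ θ⁴` ((S3), (A4.3.3)) hits the Weil line exactly when the surface periods
`∫_S f^* w_σ = ∫_B z ∧ w_σ` do not all vanish: Proposition A5.5 (p5's `pairing_identity_weil`) computes
the Weil coordinates of `y` as `weilConstant · ∫_B z ∧ w_σ`, and Lemma A5.6 reads them off.  With the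
model's `pontryagin` (`A2PontryaginModel`) and `weilProjModel` (`A2WeilProjection`) this file closes the
loop as an equivalence:

* `weilCoeffConstant P₀ c := |P₀|! · (∏_{P₀} c) · vol ≠ 0` (all `c_p ≠ 0`);
* **`integral_pontryagin_mul_ET_mul_weil`**: `∫_B (z ⋆ θ^{|P₀|}) ∧ E_{univ ∖ P₀} ∧ w_{P₀,s} =
  weilCoeffConstant · ∫_B z ∧ w_{P₀,s}` (Prop. A5.5 divided by `|I_σ|! ∏_{I_σ} c`, Lemma A5.4);
* **`repr_weilIndex_pontryagin`**: the `w_{P₀,s}`-coordinate of `z ⋆ θ^{|P₀|}` is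
  `± weilCoeffConstant · ∫_B z ∧ w_{P₀,!s}`;
* **`weilProjModel_pontryagin_eq_zero_iff`**: for a family `W` of Weil data of common size `r ≥ 1`,
  `p_W(z ⋆ θ^r) = 0 ↔ ∀ (P₀, s) ∈ W, ∫_B z ∧ w_{P₀,!s} = 0`, i.e.
  **`weilProjModel_pontryagin_ne_zero_iff`**: `p_W(y) ≠ 0 ↔ ∃ σ, ∫_B z ∧ w_σ ≠ 0` — the non-vanishing
  input (N) is equivalent to `y` having a non-zero Weil component, in the model;
* **`weilProjModel_pontryagin_ne_zero_example`**: a positive instance — for `|P₀| = 4` and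
  `z = E_{univ ∖ P₀} ∧ w_{P₀,!s}` (degree `2|ι| − 4 = deg f_*(1_S)`), `p_W(z ⋆ θ⁴) ≠ 0`.

Seat p6 (A2 owner), gen 16.  §8 (d): uses an L-value-free non-vanishing device: NO.
-/

namespace Summit.Ventures.HodgeRepro2.A2WeilProjectionPeriod

open WeilPlanes WeilIntegral WeilDetect A2ModelDuality A2PontryaginModel A2WeilProjection

variable {ι : Type*} [DecidableEq ι] [Fintype ι]

/-- The constant `|P₀|! · (∏_{p ∈ P₀} c_p) · vol`. -/
noncomputable def weilCoeffConstant (P₀ : Finset ι) (c : ι → ℂ) : ℂ :=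
  ((P₀.card.factorial : ℂ) * ∏ p ∈ P₀, c p) * vol ι

/-- `weilCoeffConstant ≠ 0` when all `c_p ≠ 0`. -/
theorem weilCoeffConstant_ne_zero (P₀ : Finset ι) (c : ι → ℂ) (hc : ∀ p, c p ≠ 0) :
    weilCoeffConstant P₀ c ≠ 0 := by
  unfold weilCoeffConstant
  refine mul_ne_zero (mul_ne_zero ?_ ?_) (vol_ne_zero ι)
  · exact Nat.cast_ne_zero.mpr (Nat.factorial_ne_zero _)
  · exact Finset.prod_ne_zero_iff.mpr fun p _ => hc p

/-- `weilConstant = (|I|! ∏_{I} c) · weilCoeffConstant` with `I = univ ∖ P₀`. -/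
theorem weilConstant_eq (P₀ : Finset ι) (c : ι → ℂ) :
    weilConstant P₀ c =
      (((Finset.univ \ P₀).card.factorial : ℂ) * ∏ p ∈ Finset.univ \ P₀, c p) *
        weilCoeffConstant P₀ c := by
  unfold weilConstant weilCoeffConstant
  rw [← Finset.prod_sdiff (Finset.subset_univ P₀)]
  ring

/-- `∫_B (z ⋆ θ^{|P₀|}) ∧ E_{univ ∖ P₀} ∧ w_{P₀,s} = weilCoeffConstant · ∫_B z ∧ w_{P₀,s}` for all
`c_p ≠ 0` (Proposition A5.5 with `θ^{|I|} ∧ w = |I|! (∏_I c) E_I ∧ w`, Lemma A5.4). -/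
theorem integral_pontryagin_mul_ET_mul_weil (P₀ : Finset ι) (s : Bool) (c : ι → ℂ)
    (hc : ∀ p, c p ≠ 0) (z : A ι) :
    integral (pontryagin z (theta c ^ P₀.card) * (ET (Finset.univ \ P₀) * weil P₀ s)) =
      weilCoeffConstant P₀ c * integral (z * weil P₀ s) := by
  have hE : ∀ p ∈ P₀, E p * weil P₀ s = 0 := fun p hp =>
    E_mul_mono_of_mem (mem_weilList.mpr ⟨hp, rfl⟩)
  have h := integral_pontryagin_theta_pow_mul_weil P₀ s c z
  rw [theta_pow_card_mul c P₀ _ hE, mul_smul_comm, map_smul, smul_eq_mul, weilConstant_eq] at h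
  have hK : (((Finset.univ \ P₀).card.factorial : ℂ) * ∏ p ∈ Finset.univ \ P₀, c p) ≠ 0 :=
    mul_ne_zero (Nat.cast_ne_zero.mpr (Nat.factorial_ne_zero _))
      (Finset.prod_ne_zero_iff.mpr fun p _ => hc p)
  apply mul_left_cancel₀ hK
  calc (((Finset.univ \ P₀).card.factorial : ℂ) * ∏ p ∈ Finset.univ \ P₀, c p) *
        integral (pontryagin z (theta c ^ P₀.card) * (ET (Finset.univ \ P₀) * weil P₀ s))
      = (((Finset.univ \ P₀).card.factorial : ℂ) * ∏ p ∈ Finset.univ \ P₀, c p) *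
          weilCoeffConstant P₀ c * integral (z * weil P₀ s) := h
    _ = _ := by ring

/-- The `w_{P₀,s}`-coordinate of `y = z ⋆ θ^{|P₀|}` is `± weilCoeffConstant · ∫_B z ∧ w_{P₀,!s}`. -/
theorem repr_weilIndex_pontryagin (P₀ : Finset ι) (s : Bool) (c : ι → ℂ) (hc : ∀ p, c p ≠ 0)
    (z : A ι) :
    ∃ ε : ℂ, (ε = 1 ∨ ε = -1) ∧
      (aBasis (ι := ι)).repr (pontryagin z (theta c ^ P₀.card)) (weilIndex P₀ s) =
        ε * (weilCoeffConstant P₀ c * integral (z * weil P₀ (!s))) := by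
  obtain ⟨ε, hε, h⟩ := repr_weilIndex (pontryagin z (theta c ^ P₀.card)) P₀ s
  exact ⟨ε, hε, by rw [h, integral_pontryagin_mul_ET_mul_weil P₀ (!s) c hc z]⟩

/-- `weilIndex` is injective on Weil data with non-empty plane sets. -/
theorem weilIndex_injective {P₀ P₀' : Finset ι} {s s' : Bool} (hP : P₀.Nonempty)
    (h : weilIndex P₀ s = weilIndex P₀' s') : P₀ = P₀' ∧ s = s' := by
  have key : ∀ j : Gen ι, j ∈ weilList P₀ s ↔ j ∈ weilList P₀' s' := by
    intro j
    rw [← Equiv.symm_apply_apply enum j, ← mem_weilIndex, ← mem_weilIndex, h]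
  obtain ⟨p, hp⟩ := hP
  have hps : ((p, s) : Gen ι) ∈ weilList P₀' s' :=
    (key (p, s)).mp (mem_weilList.mpr ⟨hp, rfl⟩)
  rw [mem_weilList] at hps
  obtain ⟨_, rfl⟩ := hps
  refine ⟨?_, rfl⟩
  ext q
  constructor
  · intro hq
    exact (mem_weilList.mp ((key (q, s)).mp (mem_weilList.mpr ⟨hq, rfl⟩))).1
  · intro hq
    exact (mem_weilList.mp ((key (q, s)).mpr (mem_weilList.mpr ⟨hq, rfl⟩))).1

/-- The coordinates of `weilProjModel W y` at the Weil indices of `W` are those of `y`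
(`r ≥ 1`, all plane sets of `W` of size `r`). -/
theorem repr_weilProjModel (W : Finset (Finset ι × Bool)) (r : ℕ) (hr : 1 ≤ r)
    (hW : ∀ d ∈ W, d.1.card = r) (y : A ι) {d₀ : Finset ι × Bool} (hd₀ : d₀ ∈ W) :
    (aBasis (ι := ι)).repr (weilProjModel W y) (weilIndex d₀.1 d₀.2) =
      (aBasis (ι := ι)).repr y (weilIndex d₀.1 d₀.2) := by
  unfold weilProjModel
  rw [map_sum, Finsupp.finsetSum_apply, Finset.sum_eq_single d₀]
  · rw [map_smul, Finsupp.smul_apply, Module.Basis.repr_self, Finsupp.single_eq_same, smul_eq_mul,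
      mul_one]
  · intro d hd hne
    rw [map_smul, Finsupp.smul_apply, Module.Basis.repr_self, Finsupp.single_eq_of_ne, smul_zero]
    intro heq
    apply hne
    have hP : d.1.Nonempty := by
      rw [← Finset.card_pos, hW d hd]
      exact hr
    obtain ⟨h1, h2⟩ := weilIndex_injective hP heq.symm
    exact Prod.ext h1 h2
  · intro h
    exact absurd hd₀ h

/-- **`p_W(z ⋆ θ^r) = 0` iff every period `∫_B z ∧ w_{P₀,!s}` vanishes** (`(P₀, s)` over a family
`W` of Weil data of common size `r ≥ 1`, all `c_p ≠ 0`). -/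
theorem weilProjModel_pontryagin_eq_zero_iff (W : Finset (Finset ι × Bool)) (r : ℕ) (hr : 1 ≤ r)
    (hW : ∀ d ∈ W, d.1.card = r) (c : ι → ℂ) (hc : ∀ p, c p ≠ 0) (z : A ι) :
    weilProjModel W (pontryagin z (theta c ^ r)) = 0 ↔
      ∀ d ∈ W, integral (z * weil d.1 (!d.2)) = 0 := by
  constructor
  · intro h d hd
    have h1 := repr_weilProjModel W r hr hW (pontryagin z (theta c ^ r)) hd
    rw [h, map_zero, Finsupp.zero_apply] at h1
    obtain ⟨ε, hε, h2⟩ := repr_weilIndex_pontryagin d.1 d.2 c hc z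
    rw [hW d hd] at h2
    rw [← h1, eq_comm, mul_eq_zero, mul_eq_zero] at h2
    rcases h2 with h2 | h2 | h2
    · exfalso
      rcases hε with rfl | rfl <;> norm_num at h2
    · exact absurd h2 (weilCoeffConstant_ne_zero d.1 c hc)
    · exact h2
  · intro h
    apply weilProjModel_eq_zero_of_forall_integral
    intro d hd
    rw [← hW d hd, integral_pontryagin_mul_ET_mul_weil d.1 (!d.2) c hc z, h d hd, mul_zero]

/-- **The non-vanishing input (N), in the model: `p_W(y) ≠ 0 ↔ ∃ σ, ∫_B z ∧ w_σ ≠ 0`** for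
`y = z ⋆ θ^r`. -/
theorem weilProjModel_pontryagin_ne_zero_iff (W : Finset (Finset ι × Bool)) (r : ℕ) (hr : 1 ≤ r)
    (hW : ∀ d ∈ W, d.1.card = r) (c : ι → ℂ) (hc : ∀ p, c p ≠ 0) (z : A ι) :
    weilProjModel W (pontryagin z (theta c ^ r)) ≠ 0 ↔
      ∃ d ∈ W, integral (z * weil d.1 (!d.2)) ≠ 0 := by
  rw [Ne, weilProjModel_pontryagin_eq_zero_iff W r hr hW c hc z]
  simp only [not_forall, exists_prop, ne_eq]

omit [Fintype ι] in
/-- `E_T` is central. -/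
theorem ET_comm (T : Finset ι) (x : A ι) : x * ET T = ET T * x :=
  Subalgebra.mem_center_iff.mp (∏ p ∈ T, Ec p).2 x

/-- **A positive instance.**  For `|P₀| = 4`, the class `z := E_{univ ∖ P₀} ∧ w_{P₀,!s}` (a model
class of degree `2|ι| − 4`, the degree of `f_*(1_S)`) has the period `∫_B z ∧ w_{P₀,s} = ± vol ≠ 0`
(p5's `integral_weil_conj_mul_ET_mul_weil`), so `y = z ⋆ θ⁴` has a NON-ZERO Weil component:
`p_W(y) ≠ 0` for `W ∋ (P₀, !s)`.  The transfer of the model does reach the Weil line. -/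
theorem weilProjModel_pontryagin_ne_zero_example (P₀ : Finset ι) (hP : P₀.card = 4) (s : Bool)
    (c : ι → ℂ) (hc : ∀ p, c p ≠ 0) :
    weilProjModel {(P₀, !s)}
      (pontryagin (ET (Finset.univ \ P₀) * weil P₀ (!s)) (theta c ^ 4)) ≠ 0 := by
  rw [weilProjModel_pontryagin_ne_zero_iff {(P₀, !s)} 4 (by norm_num)
    (by simpa using hP) c hc]
  refine ⟨(P₀, !s), Finset.mem_singleton_self _, ?_⟩
  simp only [Bool.not_not]
  rw [mul_assoc, ← mul_assoc, ← ET_comm, integral_weil_conj_mul_ET_mul_weil P₀ s hP]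
  exact vol_ne_zero ι

end Summit.Ventures.HodgeRepro2.A2WeilProjectionPeriod
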